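import Summits.CriticalPhenomena.PercolationContinuityZ3.Theorems.PercLowPointHalfSpaceBoundaryTwoArmDecayStubForestNodes
import Summits.CriticalPhenomena.PercolationContinuityZ3.Theorems.PercLowPointHalfSpaceBoundaryTwoArmDecayStubReduction

/-!
# Stub `stub_forest` of crux `BoundaryTwoArmDecay` (stmt-CriticalPhenomena-0911), part 3: pieces and ♭-roots

Helper file for the stub `stub_forest` (the merge-forest inequality, THE LEVER of line
`merge-forest-level-bridges`) of the crux skeleton `Cruxes/BoundaryTwoArmDecay/Lines/merge_forest_level_bridges.lean`
(crux `PercLowPointHalfSpace.BoundaryTwoArmDecay`, stmt-CriticalPhenomena-0911); lands with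
`--supports stmt-CriticalPhenomena-0911` (registered def-free sub-goal `stub_forest_pathFinset`).  Definitions in part 1, the forest in part 2.

* PIECES (`exists_piece`, `card_le_Dpieces`): every node contains a finite self-connected open vertex set inside
  `ℍ ∩ B_{5r}` with two vertices `u, v`, `2|u i - v i| ≥ h` — the vertex set (`exists_finset_of_pathIn`, the sub-goal)
  of an open path of the cluster up to its first exit from the box of radius `< h/2` around a window vertex (needs the
  open edges to be lattice edges, `StubReduction.abs_sub_le_one_of_adj`); so `k` distinct minimal nodes exhibit
  `k ∈ Dset`, i.e. `k ≤ Dpieces`.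
* Geometry of a ♭-root `x ∈ [0,r)³` at level `t = x 0` (event `LBflatAt r h x`): its node `nd x = (t, K_t(x))` and the
  two CHILDREN `cm x`, `cp x` (the `H_{t+1}`-clusters of the two ♭-witnesses, which lie in the window) are nodes, and
  the children lie on the two SIDES of the bridge `fl x` (`xside_of_mem_cm`, `eside_of_mem_cp`).
-/

noncomputable section

namespace Summit.CriticalPhenomena.PercolationContinuityZ3.Theorems.BoundaryTwoArmDecay

open MeasureTheory
open Literature.Probability.Percolation Literature.Probability.LatticeModels
open Summit.CriticalPhenomena.PercolationContinuityZ3.Theorems.BoundaryTwoArmDecay.Negative (H e μ)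

namespace StubForest

variable {ω : BondConfig (Site 3)} {r h : ℕ}

/-! ### Pieces: every node contains a macroscopic open piece inside `ℍ ∩ B_{5r}` -/

/-- Adding one adjacent vertex to a self-connected finite set keeps it self-connected. -/
theorem pathIn_insert {V : Type*} [DecidableEq V] {G : SimpleGraph V} {S : Finset V} {p q : V}
    (hconn : ∀ a ∈ S, ∀ b ∈ S, PathIn G (↑S : Set V) a b) (hp : p ∈ S) (hpq : G.Adj p q) :
    ∀ a ∈ insert q S, ∀ b ∈ insert q S, PathIn G (↑(insert q S) : Set V) a b := by
  have hsub : (↑S : Set V) ⊆ ↑(insert q S) := by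
    rw [Finset.coe_insert]
    exact Set.subset_insert _ _
  have hq : q ∈ (↑(insert q S) : Set V) := by simp
  have key : ∀ a ∈ S, PathIn G (↑(insert q S) : Set V) a q := fun a ha =>
    ((hconn a ha p hp).mono hsub).tail hpq hq
  intro a ha b hb
  rw [Finset.mem_insert] at ha hb
  rcases ha with rfl | ha <;> rcases hb with rfl | hb
  · exact PathIn.refl hq
  · exact (key b hb).symm
  · exact key a ha
  · exact (hconn a ha b hb).mono hsub

/-- **The vertex set of a path.** A path inside `A` is carried by a finite self-connected subset of `A`
containing its endpoints. -/
theorem exists_finset_of_pathIn {V : Type*} [DecidableEq V] {G : SimpleGraph V} {A : Set V} {u v : V}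
    (h : PathIn G A u v) :
    ∃ S : Finset V, u ∈ S ∧ v ∈ S ∧ (↑S : Set V) ⊆ A ∧ ∀ a ∈ S, ∀ b ∈ S, PathIn G (↑S : Set V) a b := by
  obtain ⟨hu, hr⟩ := h
  induction hr with
  | refl =>
    refine ⟨{u}, Finset.mem_singleton_self u, Finset.mem_singleton_self u, by simpa using hu, ?_⟩
    intro a ha b hb
    rw [Finset.mem_singleton] at ha hb
    subst ha hb
    exact PathIn.refl (by simp)
  | @tail b c _ hbc ih =>
    obtain ⟨S, huS, hbS, hSA, hconn⟩ := ih
    refine ⟨insert c S, Finset.mem_insert_of_mem huS, Finset.mem_insert_self c S, ?_,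
      pathIn_insert hconn hbS hbc.1⟩
    rw [Finset.coe_insert]
    exact Set.insert_subset hbc.2 hSA

/-- `2|d| < c` unfolded. -/
theorem two_mul_abs_lt {d c : ℤ} (hd : 2 * |d| < c) : 2 * d < c ∧ -c < 2 * d := by
  rcases abs_cases d with ⟨h1, _⟩ | ⟨h1, _⟩ <;> rw [h1] at hd <;> constructor <;> omega

/-- **Every node contains a piece**: a finite self-connected open vertex set inside `ℍ ∩ B_{5r}` and inside the
node, with two vertices `u, v`, `2|u i - v i| ≥ h` (first exit of an open path of the cluster from the box of
radius `< h/2` around a window vertex of the node).  Needs the open edges to be lattice edges. -/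
theorem exists_piece (hω : ω ⊆ (zdGraph 3).edgeSet) (hh : 1 ≤ h) (hhr : h ≤ r)
    {n : ℤ × Set (Site 3)} (hn : n ∈ nodes ω r h) :
    ∃ S : Finset (Site 3), (↑S : Set (Site 3)) ⊆ {z : Site 3 | 0 ≤ z 0} ∩ ↑(box 3 (5 * r)) ∧
      (∀ a ∈ S, ∀ b ∈ S, ω ∈ openConnIn (↑S : Set (Site 3)) a b) ∧
      (∃ u ∈ S, ∃ v ∈ S, ∃ i : Fin 3, (h : ℤ) ≤ 2 * |u i - v i|) ∧ (↑S : Set (Site 3)) ⊆ n.2 := by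
  obtain ⟨hs0, -, hbig, -⟩ := mem_nodes_iff.1 hn
  obtain ⟨hzB, hz⟩ := gen_spec hn
  obtain ⟨hzbox, hz0⟩ := mem_Bw.1 hzB
  -- a far vertex `y` of the cluster
  obtain ⟨y, hy, i, hyi⟩ : ∃ y ∈ n.2, ∃ i : Fin 3, (h : ℤ) ≤ 2 * |y i - gen ω r n i| := by
    obtain ⟨a, ha, b, hb, i, hi⟩ := hbig
    by_cases hai : (h : ℤ) ≤ 2 * |a i - gen ω r n i|
    · exact ⟨a, ha, i, hai⟩
    · refine ⟨b, hb, i, ?_⟩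
      have h1 : |a i - b i| ≤ |a i - gen ω r n i| + |b i - gen ω r n i| := by
        calc |a i - b i| = |(a i - gen ω r n i) - (b i - gen ω r n i)| := by ring_nf
          _ ≤ |a i - gen ω r n i| + |b i - gen ω r n i| := abs_sub _ _
      linarith
  rw [hz] at hy
  -- an open path from the generator to `y` inside `H_s`, and its first exit from the small box
  have hpath : PathIn (openGraph ω) (Hge n.1) (gen ω r n) y := DCT16.pathIn_of_mem_openConnIn hy
  have hzR : gen ω r n ∈ {w : Site 3 | ∀ j, 2 * |w j - gen ω r n j| < h} := by
    intro j
    simp only [sub_self, abs_zero, mul_zero]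
    exact_mod_cast hh
  have hyR : y ∉ {w : Site 3 | ∀ j, 2 * |w j - gen ω r n j| < h} := fun hyR => by
    have := hyR i
    linarith
  obtain ⟨p, q, hp, hq, hqH, hpq, hzp⟩ := hpath.exit hzR hyR
  obtain ⟨S₀, hzS, hpS, hS₀, hconn⟩ := exists_finset_of_pathIn hzp
  have hadj : (zdGraph 3).Adj p q := by
    rw [openGraph_adj] at hpq
    exact hω hpq.1
  have hq1 := StubReduction.abs_sub_le_one_of_adj hadj
  have hS₀H : (↑S₀ : Set (Site 3)) ⊆ Hge n.1 := hS₀.trans Set.inter_subset_right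
  refine ⟨insert q S₀, ?_, ?_, ⟨q, Finset.mem_insert_self _ _, gen ω r n, Finset.mem_insert_of_mem hzS, ?_⟩,
    ?_⟩
  · -- inside `ℍ ∩ B_{5r}`
    rw [Finset.coe_insert, Set.insert_subset_iff]
    constructor
    · refine ⟨le_trans hs0 hqH, Finset.mem_coe.2 (mem_box.2 fun j => ?_)⟩
      have h1 := two_mul_abs_lt (hp j)
      have h2 := abs_le.1 (hq1 j)
      have h3 := hzbox j
      push_cast at h3 ⊢
      omega
    · intro w hw
      obtain ⟨hwR, hwH⟩ := hS₀ hw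
      refine ⟨le_trans hs0 hwH, Finset.mem_coe.2 (mem_box.2 fun j => ?_)⟩
      have h1 := two_mul_abs_lt (hwR j)
      have h3 := hzbox j
      push_cast at h3 ⊢
      omega
  · -- self-connected
    intro a ha b hb
    exact DCT16.mem_openConnIn_of_pathIn (pathIn_insert hconn hpS hpq a ha b hb)
  · -- the far pair `(q, gen n)`
    simp only [Set.mem_setOf_eq, not_forall, not_lt] at hq
    exact hq
  · -- inside the node
    rw [hz, Finset.coe_insert, Set.insert_subset_iff]
    constructor
    · exact DCT16.mem_openConnIn_of_pathIn ((hzp.mono Set.inter_subset_right).tail hpq hqH)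
    · intro w hw
      exact DCT16.mem_openConnIn_of_pathIn ((hconn _ hzS _ hw).mono hS₀H)

/-- The defining properties of the piece of a node. -/
theorem piece_spec (hω : ω ⊆ (zdGraph 3).edgeSet) (hh : 1 ≤ h) (hhr : h ≤ r)
    {n : ℤ × Set (Site 3)} (hn : n ∈ nodes ω r h) :
    (↑(piece ω r h n) : Set (Site 3)) ⊆ {z : Site 3 | 0 ≤ z 0} ∩ ↑(box 3 (5 * r)) ∧
      (∀ a ∈ piece ω r h n, ∀ b ∈ piece ω r h n, ω ∈ openConnIn (↑(piece ω r h n) : Set (Site 3)) a b) ∧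
      (∃ u ∈ piece ω r h n, ∃ v ∈ piece ω r h n, ∃ i : Fin 3, (h : ℤ) ≤ 2 * |u i - v i|) ∧
      (↑(piece ω r h n) : Set (Site 3)) ⊆ n.2 := by
  rw [piece, dif_pos (exists_piece hω hh hhr hn)]
  exact (exists_piece hω hh hhr hn).choose_spec

/-- **Leaves are few**: a set of minimal nodes has at most `D(r,h)(ω)` members (their pieces are pairwise
disjoint). -/
theorem card_le_Dpieces (hω : ω ⊆ (zdGraph 3).edgeSet) (hh : 1 ≤ h) (hhr : h ≤ r)
    {T : Finset (ℤ × Set (Site 3))} (hT : T ⊆ minimals ω r h) : T.card ≤ Dpieces r h ω := by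
  have hTn : ∀ m ∈ T, m ∈ nodes ω r h := fun m hm => (mem_minimals_iff.1 (hT hm)).1
  refine le_Dpieces_of_mem ⟨fun a => piece ω r h (T.equivFin.symm a).1, fun a => ?_, fun a => ?_,
    fun a => ?_, fun a b hab => ?_⟩
  · exact (piece_spec hω hh hhr (hTn _ (T.equivFin.symm a).2)).1
  · exact (piece_spec hω hh hhr (hTn _ (T.equivFin.symm a).2)).2.1
  · exact (piece_spec hω hh hhr (hTn _ (T.equivFin.symm a).2)).2.2.1
  · have hne : (T.equivFin.symm a).1 ≠ (T.equivFin.symm b).1 := fun hab' =>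
      hab (T.equivFin.symm.injective (Subtype.ext hab'))
    exact Finset.disjoint_coe.1 ((minimals_disjoint (hT (T.equivFin.symm a).2)
      (hT (T.equivFin.symm b).2) hne).mono (piece_spec hω hh hhr (hTn _ (T.equivFin.symm a).2)).2.2.2
      (piece_spec hω hh hhr (hTn _ (T.equivFin.symm b).2)).2.2.2)

/-! ### Geometry of the ♭-roots: node, the two children, the two sides of the bridge -/

/-- `|R| = r³`. -/
theorem card_Rset (r : ℕ) : (Rset r).card = r ^ 3 := by
  rw [Rset, Fintype.card_piFinset_const, Int.card_Ico]
  simp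

/-- Roots lie in `B_r`. -/
theorem mem_box_of_mem_Rset {x : Site 3} (hx : x ∈ Rset r) : x ∈ box 3 r := by
  rw [mem_Rset] at hx
  exact mem_box.2 fun j => by have := hx j; omega

/-- The defining properties of `um`. -/
theorem um_spec {x : Site 3} (hx : ω ∈ LBflatAt r h x) :
    um ω r h x - x ∈ box 3 r ∧ ω \ {fl x} ∈ openConnIn (Hge (x 0)) x (um ω r h x) ∧
      ω ∈ BigAbove h (x 0) (um ω r h x) := by
  rw [um, dif_pos hx]
  exact hx.2.2.1.choose_spec

/-- The defining properties of `up`. -/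
theorem up_spec {x : Site 3} (hx : ω ∈ LBflatAt r h x) :
    up ω r h x - (x + e) ∈ box 3 r ∧ ω \ {fl x} ∈ openConnIn (Hge (x 0)) (x + e) (up ω r h x) ∧
      ω ∈ BigAbove h (x 0) (up ω r h x) := by
  rw [up, dif_pos hx]
  exact hx.2.2.2.choose_spec

/-- `x + e ∈ H_t`, `t = x 0`. -/
theorem add_e_mem_Hge (x : Site 3) : x + e ∈ Hge (x 0) := by
  change x 0 ≤ (x + e) 0
  rw [add_e_zero]

/-- `x ↔ x + e in H_t` through the open floor edge. -/
theorem conn_self_add_e {x : Site 3} (hx : ω ∈ LBflatAt r h x) : ω ∈ openConnIn (Hge (x 0)) x (x + e) := by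
  refine DCT16.mem_openConnIn_of_pathIn (PathIn.of_adj (show x 0 ≤ x 0 from le_rfl) (add_e_mem_Hge x) ?_)
  rw [openGraph_adj]
  exact ⟨hx.1, ne_add_e x⟩

/-- `x ↔ um in H_t`. -/
theorem conn_um {x : Site 3} (hx : ω ∈ LBflatAt r h x) : ω ∈ openConnIn (Hge (x 0)) x (um ω r h x) :=
  isUpperSet_openConnIn _ _ _ (fun _ hf => hf.1) (um_spec hx).2.1

/-- `x ↔ up in H_t`. -/
theorem conn_up {x : Site 3} (hx : ω ∈ LBflatAt r h x) : ω ∈ openConnIn (Hge (x 0)) x (up ω r h x) :=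
  LowPoint.conn_trans (conn_self_add_e hx) (isUpperSet_openConnIn _ _ _ (fun _ hf => hf.1) (up_spec hx).2.1)

/-- Connections inside `H_{t+1}` avoid the floor edge at level `t`. -/
theorem diff_fl_conn {x a b : Site 3} (h1 : ω ∈ openConnIn (Hge (x 0 + 1)) a b) :
    ω \ {fl x} ∈ openConnIn (Hge (x 0)) a b :=
  LowPoint.conn_mono (LowPoint.level_antitone (by omega))
    (diff_conn_of_notMem (S := Hge (x 0 + 1)) (by simp) h1)

/-- The `x`-side child lies on the `x`-side of the bridge. -/
theorem xside_of_mem_cm {x w : Site 3} (hx : ω ∈ LBflatAt r h x) (hw : w ∈ (cm ω r h x).2) :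
    ω \ {fl x} ∈ openConnIn (Hge (x 0)) x w :=
  LowPoint.conn_trans (um_spec hx).2.1 (diff_fl_conn hw)

/-- The `x + e`-side child lies on the `x + e`-side of the bridge. -/
theorem eside_of_mem_cp {x w : Site 3} (hx : ω ∈ LBflatAt r h x) (hw : w ∈ (cp ω r h x).2) :
    ω \ {fl x} ∈ openConnIn (Hge (x 0)) (x + e) w :=
  LowPoint.conn_trans (up_spec hx).2.1 (diff_fl_conn hw)

/-- The `x`-side child lies in the node. -/
theorem cm_subset {x : Site 3} (hx : ω ∈ LBflatAt r h x) : (cm ω r h x).2 ⊆ (nd ω x).2 := fun _ hw =>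
  LowPoint.conn_trans (conn_um hx) (K_mono (by omega) _ hw)

/-- The `x + e`-side child lies in the node. -/
theorem cp_subset {x : Site 3} (hx : ω ∈ LBflatAt r h x) : (cp ω r h x).2 ⊆ (nd ω x).2 := fun _ hw =>
  LowPoint.conn_trans (conn_up hx) (K_mono (by omega) _ hw)

/-- The `x`-side child is big and contains its witness. -/
theorem cm_big {x : Site 3} (hx : ω ∈ LBflatAt r h x) :
    (cm ω r h x).2 ∈ Big h ∧ um ω r h x ∈ (cm ω r h x).2 :=
  big_K_of_bigAbove (um_spec hx).2.2

/-- The `x + e`-side child is big and contains its witness. -/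
theorem cp_big {x : Site 3} (hx : ω ∈ LBflatAt r h x) :
    (cp ω r h x).2 ∈ Big h ∧ up ω r h x ∈ (cp ω r h x).2 :=
  big_K_of_bigAbove (up_spec hx).2.2

/-- A root lies in the window. -/
theorem mem_Bw_of_mem_Rset {x : Site 3} (hxR : x ∈ Rset r) : x ∈ Bw r := by
  rw [mem_Rset] at hxR
  refine mem_Bw.2 ⟨fun j => ?_, (hxR 0).1⟩
  have := hxR j
  push_cast
  omega

/-- The `x`-side witness lies in the window. -/
theorem um_mem_Bw {x : Site 3} (hx : ω ∈ LBflatAt r h x) (hxR : x ∈ Rset r) : um ω r h x ∈ Bw r := by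
  rw [mem_Rset] at hxR
  have hb := mem_box.1 (um_spec hx).1
  have h0 : x 0 + 1 ≤ um ω r h x 0 := K_subset_Hge _ _ _ (cm_big hx).2
  refine mem_Bw.2 ⟨fun j => ?_, by have := hxR 0; omega⟩
  have h1 := hb j
  have h2 := hxR j
  simp only [Pi.sub_apply] at h1
  push_cast
  omega

/-- The `x + e`-side witness lies in the window. -/
theorem up_mem_Bw {x : Site 3} (hx : ω ∈ LBflatAt r h x) (hxR : x ∈ Rset r) : up ω r h x ∈ Bw r := by
  rw [mem_Rset] at hxR
  have hb := mem_box.1 (up_spec hx).1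
  have h0 : x 0 + 1 ≤ up ω r h x 0 := K_subset_Hge _ _ _ (cp_big hx).2
  refine mem_Bw.2 ⟨fun j => ?_, by have := hxR 0; omega⟩
  have h1 := hb j
  have h2 := hxR j
  have h3 := e_apply_mem j
  simp only [Pi.sub_apply, Pi.add_apply] at h1
  push_cast
  omega

/-- The node of a ♭-root is a node. -/
theorem nd_mem_nodes {x : Site 3} (hx : ω ∈ LBflatAt r h x) (hxR : x ∈ Rset r) : nd ω x ∈ nodes ω r h := by
  have h0 := (mem_Rset.1 hxR) 0
  exact mem_nodes_iff.2 ⟨h0.1, by change x 0 ≤ _; omega, big_mono (cm_big hx).1 (cm_subset hx), x,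
    mem_Bw_of_mem_Rset hxR, rfl⟩

/-- The `x`-side child is a node. -/
theorem cm_mem_nodes {x : Site 3} (hx : ω ∈ LBflatAt r h x) (hxR : x ∈ Rset r) :
    cm ω r h x ∈ nodes ω r h := by
  have h0 := (mem_Rset.1 hxR) 0
  exact mem_nodes_iff.2 ⟨by change 0 ≤ x 0 + 1; omega, by change x 0 + 1 ≤ _; omega, (cm_big hx).1,
    um ω r h x, um_mem_Bw hx hxR, rfl⟩

/-- The `x + e`-side child is a node. -/
theorem cp_mem_nodes {x : Site 3} (hx : ω ∈ LBflatAt r h x) (hxR : x ∈ Rset r) :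
    cp ω r h x ∈ nodes ω r h := by
  have h0 := (mem_Rset.1 hxR) 0
  exact mem_nodes_iff.2 ⟨by change 0 ≤ x 0 + 1; omega, by change x 0 + 1 ≤ _; omega, (cp_big hx).1,
    up ω r h x, up_mem_Bw hx hxR, rfl⟩

/-- The node of a ♭-root is not minimal (it has the child `cm`). -/
theorem nd_not_mem_minimals {x : Site 3} (hx : ω ∈ LBflatAt r h x) (hxR : x ∈ Rset r) :
    nd ω x ∉ minimals ω r h :=
  not_mem_minimals_of_child (cm_mem_nodes hx hxR) rfl (cm_subset hx)

/-! ### Registered sub-goal -/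

/-- **Registered sub-goal `stub_forest_pathFinset`** (def-free): the vertex set of a path inside `A` is a finite
self-connected subset of `A` containing the endpoints (the tool behind the pieces). -/
theorem stub_forest_pathFinset : ∀ {V : Type} [DecidableEq V] {G : SimpleGraph V} {A : Set V} {u v : V}, PathIn G A u v → ∃ S : Finset V, u ∈ S ∧ v ∈ S ∧ (↑S : Set V) ⊆ A ∧ ∀ a ∈ S, ∀ b ∈ S, PathIn G (↑S : Set V) a b :=
  fun h => exists_finset_of_pathIn h

end StubForest

end Summit.CriticalPhenomena.PercolationContinuityZ3.Theorems.BoundaryTwoArmDecay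

end
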